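import Summits.HodgeConjecture.HodgeConjecture.Theses.BoundaryReadout
import Summits.HodgeConjecture.HodgeConjecture.Theses.QbarEnvelope
import Summits.HodgeConjecture.HodgeConjecture.Theorems.PadicSemiregularLiftHodgeBeyondAnchorsDiagonalPullback
import Literature.AlgebraicGeometry.HodgeTheory.AlgebraicClassesPullback
import Literature.AlgebraicGeometry.HodgeTheory.HodgeConjectureQbarVoisinProofs
import Literature.AlgebraicGeometry.HodgeTheory.ComplexGysin
import Literature.AlgebraicTopology.CharacteristicClasses.ProjectiveSpaceLerayHirsch
import HarnessLib

/-!
# Disproof of `PullbackAlgebraic` (stmt-HodgeConjecture-1071) — findings: NO KILL.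
# The crux is Fulton's Cor. 19.2 (b) on an honest carrier, and it is HC-safe by a tree theorem.

Standing disprover's work file (cdisprove, cycle 1, refuter-cdisprove-stmt-HodgeConjecture-1071-0,
2026-08-17). Prose lives in docstrings; everything is kernel-checked except the ONE theorem marked
`sorry` in §2 (a paper counterexample whose certification needs inputs the tree cannot construct).

Crux (verbatim in both routes wanting the item, `QbarEnvelope.PullbackAlgebraic` and
`BoundaryReadout.PullbackAlgebraic`, syntactically identical — §0):

  `∀ X W smooth projective /ℂ, ∀ ι : X ⟶ W, ∀ p, ι^*(Nᵖ H²ᵖ(W(ℂ); ℂ)) ⊆ Nᵖ H²ᵖ(X(ℂ); ℂ)`,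

`Nᵖ H²ᵖ = algebraicClasses = supportedClasses _ (2p) p` (Grothendieck's coniveau, `ℂ`-coefficients).

## Index of findings

* §0 IDENTITY AND CEILING. The crux is, up to binder order, the named fact
  `fulton1998_map_mem_algebraicClasses` (`pullbackAlgebraic_iff_fulton1998`; Fulton 1998 Cor. 19.2 (b),
  held copy PDF p. 365; Voisin II Prop. 9.21 (i)). `HodgeConjecture → PullbackAlgebraic` is a tree
  theorem (`HodgeBeyondAnchors.fulton1998_map_mem_algebraicClasses_of_hodgeConjecture`), hence
  `¬ PullbackAlgebraic ⊢ ¬ HodgeConjecture` (`not_hodgeConjecture_of_not_pullbackAlgebraic`):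
  NO UNCONDITIONAL KILL EXISTS SHORT OF DISPROVING THE SUMMIT AS TYPED.
* §1 DICTIONARY AUDIT (is the carrier junk?). No: scheme points carry the specialisation preorder
  `a ≤ b ↔ b ⤳ a` (Mathlib instance), closed points are minimal (`height = 0`), so `Order.coheight` IS the
  codimension used in "`Z` of codimension `≥ p`"; the generic point has coheight `0`
  (`coheight_genericPoint_eq_zero`), so `Z = X` is admissible only for `p = 0` and `Nᵖ` is not `⊤` for
  free (`genericPoint_not_mem_of_one_le_coheight`); `IsSmoothProjective` = smooth of relative dimension
  + closed immersion into `ℙᴺ` + geometrically irreducible (real Mathlib predicates); `complexBetti` is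
  real singular cohomology of the complex points with the analytic topology; `ℂ`-orientation families
  are non-degenerate (`orientationFamily_localClass_ne_zero`, relevant to the line's `∀ μ` stubs).
* §2 LOAD-BEARING ANALYSIS. Hypotheses of the crux: `hX : IsSmoothProjective n X`,
  `hW : IsSmoothProjective m W`.
  - `hW` (smoothness of the TARGET) is LOAD-BEARING: `PullbackAlgebraicWithoutSmoothTarget` is FALSE
    on paper (`pullbackAlgebraic_false_without_smoothTarget`, the one `sorry`): W = projective cone over
    a smooth projective surface `S` with `b₂(S) > ρ(S)`, `X = Bl_v W = ℙ(𝒪_S ⊕ L)`, `ι` = the blow-down,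
    `p = 2`; then `N² H⁴(W) = H⁴(W) ≅ H²(S)` while `ι^*` hits `[S_∞] ∪ ρ^*τ ∉ N² H⁴(X)` for `τ ∉ NS(S)_ℂ`.
    Even projectivity + normality + one isolated singularity of `W` do not save it. (A second, formal
    witness — `W = X ×_ℂ Spec ℂ[t]_(t)`, not of finite type — is recorded in the same docstring.)
  - `hX` (every hypothesis on the SOURCE) is NOT load-bearing: `PullbackAlgebraicWithoutSourceHyps`
    (X an arbitrary `ℂ`-scheme) is TRUE in print for `W` smooth quasi-projective — Chow's moving lemma
    w.r.t. the fibre-dimension stratification of `ι` — and implies the crux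
    (`pullbackAlgebraic_of_withoutSourceHyps`). Correction to the rattack note of 2026-08-17T11:45Z
    ("hX load-bearing"): for singular `X`, `Nᵖ(X)` is no longer the cycle span, but the INCLUSION
    `ι^* Nᵖ(W) ⊆ Nᵖ(X)` survives, because a moved cycle class dies off `ι⁻¹(Z')` of codimension `≥ p`.
  - projectivity / irreducibility of `W`: not load-bearing given smoothness (Fulton's refined Gysin
    needs `W` smooth only; work componentwise).
* §3 NATURAL STRENGTHENINGS — none refutable: full contravariance of the coniveau filtration
  `Nᶜ Hᵏ` (`ConiveauContravariant`, the ideation Sketch's stub the lead called "stronger than the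
  crux") is TRUE in print (Deligne span `Nᶜ Hᵏ(W) = Σ g_* H^{k-2c}(Ỹ)` — PROVED in tree,
  `supportedClasses_eq_iSup_range_complexGysin` — plus `ι^* ∘ g_* = (ᵗΓ_ι ∘ Γ_g)_*`, a correspondence of
  dimension `dim X − c`, whose action lands in classes dying off its projection: Voisin 2025 (JOMP 1)
  p. 27 ll. 27–32, p. 25 Def. 4.1; Fulton Ch. 16); it implies the crux
  (`pullbackAlgebraic_of_coniveauContravariant`). Surjectivity of `ι^*` on `Nᵖ` for closed immersions
  is false (weak Lefschetz fails off range) but is nobody's stub.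
* §4 DEGENERATE REGIMES — all TRUE and already theorems of the tree, restated in the crux's binder
  shape: `p = 0 ∨ dim X ≤ p`, `dim X ≤ 1`, `p = 1` (Lefschetz (1,1)), `dim X ≤ p + 1` (hard Lefschetz),
  `dim X ≤ 3`, `ι` flat, `ι` an isomorphism, `dim W = 0`. OPEN RANGE left to the provers:
  `dim X ≥ 4`, `2 ≤ p ≤ dim X − 2`, `ι` neither flat nor an isomorphism (equivalently, by the landed
  graph reduction `fulton1998_map_mem_algebraicClasses_iff_graph`, closed immersions of codimension ≥ 1).
* §5 LINE `normal_cone` (lead prover-line-stmt-HodgeConjecture-1071-0; skeleton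
  `Cruxes/PullbackAlgebraic/Lines/normal_cone.lean`, 6 stubs, composition kernel-checked). Stub-by-stub
  adversarial reading, degenerate cases (`r = 0`, `p = 0`, `p > dim`, empty slice, `c = 0`, arbitrary
  `μ`) and hypothesis mutation: NO STUB IS FALSE AS TYPED; every hypothesis the lead wrote is
  load-bearing on paper except the retraction `ρ` of stub 2 (idle for truth, used by the intended proof);
  typed mutants `Stub2WithoutNotSubset`, `Stub2WithoutIrreducibleSlice`, `Stub3dWithoutCNeZero` are
  recorded with their paper witnesses. One bookkeeping trap for the prover is flagged (stub 3d: the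
  `b' < b` terms need the HOMOLOGICAL projection formula, the cohomological Gysin map in negative degree
  being untypeable). Joint sufficiency is not attackable: `PullbackAlgebraic_of` is sorry-free.

LANDED UNDER `Theorems/PullbackAlgebraic/Negative/` (importable): `LoadBearing.lean` (p167223, accepted
2026-08-17 — §0: `pullbackAlgebraic_iff_qbarEnvelope`, `pullbackAlgebraic_iff_fulton1998`,
`not_hodgeConjecture_of_not_pullbackAlgebraic(_qbarEnvelope)`). Nothing else existed before this file.
Barrier catalogue: `Bloch1990_cohomologicalHodgeConjecture_singular_counterexample` and
`BarbieriVialeSrinivas1994_singularLefschetzOneOne_counterexample` (`Barriers/HodgeConjecture/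
SingularVarieties`) are the printed cousins of the §2 cone: coniveau/`K`-theoretic "algebraic classes"
misbehave on SINGULAR varieties — exactly the hypothesis the crux keeps. No barrier bites the crux.
-/

noncomputable section

-- `Summit.HodgeConjecture.HodgeConjecture.…` is the mandated namespace (single-conjunct summit).
set_option linter.dupNamespace false

namespace Summit.HodgeConjecture.HodgeConjecture.Cruxes.PullbackAlgebraic.Disproof

open CategoryTheory AlgebraicGeometry
open Literature.AlgebraicGeometry Literature.AlgebraicGeometry.Motives
open Literature.AlgebraicGeometry.HodgeTheory
open Literature.AlgebraicTopology.SingularHomology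
open Summit.HodgeConjecture.HodgeConjecture.Theses

/-! ## §0 Identity and ceiling -/

/-- The two route decls wanting the shared item are syntactically identical (`Iff` by unfolding).
[folklore] -/
theorem pullbackAlgebraic_iff_qbarEnvelope :
    BoundaryReadout.PullbackAlgebraic ↔ QbarEnvelope.PullbackAlgebraic :=
  ⟨fun h _ _ hX _ _ hW ι p c' hc' ↦ h hX hW ι p c' hc',
    fun h _ _ hX _ _ hW ι p c' hc' ↦ h hX hW ι p c' hc'⟩

/-- **The crux IS the named fact `fulton1998_map_mem_algebraicClasses`** (Fulton 1998, Cor. 19.2 (b):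
"`cl : A^*X → H^*X` … contravariant for morphisms of non-singular varieties"; Voisin II Prop. 9.21 (i)),
up to the order of the binders — nothing else. [cite: Fulton1998, §19.2 Cor. 19.2 (b)] -/
theorem pullbackAlgebraic_iff_fulton1998 :
    BoundaryReadout.PullbackAlgebraic ↔ fulton1998_map_mem_algebraicClasses :=
  ⟨fun h _ _ _ _ j hY hX p β hβ ↦ h hX hY j p β hβ, fun h _ _ hX _ _ hW ι p c' hc' ↦ h ι hW hX p c' hc'⟩

/-- **HC-safety (the ceiling of every disproof attempt).** The Hodge conjecture, as typed on the tree,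
implies the crux: pull back to a source all of whose rational `(p,p)`-classes are algebraic
(`HodgeBeyondAnchors.fulton1998_map_mem_algebraicClasses_of_hodgeConjecture`: `Nᵖ H²ᵖ(W)` is spanned by
rational `(p,p)` classes, `ι^*` preserves rationality and Hodge type). [cite: VoisinHodgeI2002, Prop. 11.20 and §7.3.2] -/
theorem pullbackAlgebraic_of_hodgeConjecture (h : _root_.HodgeConjecture) :
    BoundaryReadout.PullbackAlgebraic :=
  pullbackAlgebraic_iff_fulton1998.2
    (Theorems.HodgeBeyondAnchors.fulton1998_map_mem_algebraicClasses_of_hodgeConjecture h)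

/-- Contrapositive: **any refutation of the crux refutes the summit as typed.** So this disprover's
job reduces to (i) junk in the carrier (§1: none) or (ii) `¬ HodgeConjecture` (out of scope).
[cite: VoisinHodgeI2002, Prop. 11.20] -/
theorem not_hodgeConjecture_of_not_pullbackAlgebraic (h : ¬ BoundaryReadout.PullbackAlgebraic) :
    ¬ _root_.HodgeConjecture :=
  fun hc ↦ h (pullbackAlgebraic_of_hodgeConjecture hc)

/-! ## §1 Dictionary audit — the carrier is honest (kernel-checked sanity) -/

/-- Scheme points are ordered by SPECIALISATION, `a ≤ b ↔ b ⤳ a` (`a ∈ closure {b}`): the generic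
point is the top, closed points are minimal. This is the order in which `supportedClasses` measures
"codimension `≥ r`" as `r ≤ Order.coheight z`. [folklore] -/
example {S : Scheme} (a b : S) : a ≤ b ↔ b ⤳ a := Iff.rfl

/-- Closed points have `height 0` (they are minimal), so it is `coheight` — chains of generisations —
that counts codimension, as the docstring of `supportedClasses` claims. [folklore] -/
example {S : Scheme} {x : S} (hx : IsClosed ({x} : Set S)) : Order.height x = 0 :=
  Scheme.height_of_isClosed hx

/-- The generic point of an integral scheme has coheight `0`. [folklore] -/
theorem coheight_genericPoint_eq_zero (S : Scheme) [IsIntegral S] :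
    Order.coheight (genericPoint S) = 0 := by
  rw [Order.coheight_eq_zero]
  intro b _
  exact genericPoint_specializes b

/-- Hence `Z = X` (which would make `Nʳ = ⊤`, the complement having no complex points) is NOT an
admissible support for `r ≥ 1`: the coniveau carrier is not trivially everything. (It IS everything for
`r = 0`, `supportedClasses_zero`, and for `2 dim X ≤ 2p`, `algebraicClasses_eq_top_of_eq_zero_or_le` —
both honest.) [folklore] -/
theorem genericPoint_not_mem_of_one_le_coheight (S : Scheme) [IsIntegral S] {r : ℕ} (hr : 1 ≤ r)
    {Z : Set S} (hZ : ∀ z ∈ Z, (r : ℕ∞) ≤ Order.coheight z) : genericPoint S ∉ Z := by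
  intro h
  have h1 := hZ _ h
  rw [coheight_genericPoint_eq_zero] at h1
  have : (r : ℕ∞) = 0 := le_antisymm h1 zero_le
  have : r = 0 := by exact_mod_cast this
  omega

/-- `ℂ`-orientation families are NON-DEGENERATE: every local orientation class is non-zero (it is a
generator of `H_{2n}(X(ℂ) | x; ℂ)`). Relevant to the line's stubs 3c/3d, which quantify over ALL
`μ : OrientationFamily`: a degenerate `μ` (Gysin maps identically `0`, making `q_*(ζʳ) = c • 1`, `c ≠ 0`
unsatisfiable) does not exist. [cite: HatcherAT2002, §3.3 p. 235] -/
theorem orientationFamily_localClass_ne_zero (μ : OrientationFamily) {n : ℕ} {X : SchemeOver ℂ}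
    (hX : IsSmoothProjective n X) (x : ComplexPoints X) : (μ hX).localClass x ≠ 0 := by
  obtain ⟨e, he⟩ := (μ hX).isGenerator x
  intro h
  rw [h, map_zero] at he
  exact zero_ne_one he

/-! ## §2 Load-bearing analysis of the two hypotheses -/

/-- **The crux with every hypothesis on the TARGET dropped** (`W` an arbitrary `ℂ`-scheme).
[folklore] -/
def PullbackAlgebraicWithoutSmoothTarget : Prop :=
  ∀ ⦃n : ℕ⦄ ⦃X : SchemeOver ℂ⦄, IsSmoothProjective n X →
    ∀ ⦃W : SchemeOver ℂ⦄ (ι : X ⟶ W) (p : ℕ) (c' : complexBetti W (2 * p)),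
      c' ∈ algebraicClasses W p → complexBetti.map ι (2 * p) c' ∈ algebraicClasses X p

/-- **The crux with every hypothesis on the SOURCE dropped** (`X` an arbitrary `ℂ`-scheme).
[folklore] -/
def PullbackAlgebraicWithoutSourceHyps : Prop :=
  ∀ ⦃X : SchemeOver ℂ⦄ ⦃m : ℕ⦄ ⦃W : SchemeOver ℂ⦄, IsSmoothProjective m W →
    ∀ (ι : X ⟶ W) (p : ℕ) (c' : complexBetti W (2 * p)),
      c' ∈ algebraicClasses W p → complexBetti.map ι (2 * p) c' ∈ algebraicClasses X p

/-- Both mutants are genuine strengthenings of the crux (target side). [folklore] -/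
theorem pullbackAlgebraic_of_withoutSmoothTarget (h : PullbackAlgebraicWithoutSmoothTarget) :
    BoundaryReadout.PullbackAlgebraic :=
  fun _ _ hX _ _ _ ι p c' hc' ↦ h hX ι p c' hc'

/-- Both mutants are genuine strengthenings of the crux (source side). [folklore] -/
theorem pullbackAlgebraic_of_withoutSourceHyps (h : PullbackAlgebraicWithoutSourceHyps) :
    BoundaryReadout.PullbackAlgebraic :=
  fun _ _ _ _ _ hW ι p c' hc' ↦ h hW ι p c' hc'

/-- **`hW` is load-bearing: without smoothness of the target the crux is FALSE** (paper refutation;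
the only `sorry` of this file).

WITNESS (geometric; `W` projective, integral, normal, ONE isolated singularity; `ι` a resolution).
Let `S` be a smooth projective surface with `b₂(S) > ρ(S)` (any `S` with `p_g > 0`: an abelian surface,
a K3, `E × E`), `L` very ample on `S`, `W ⊆ ℙᴺ⁺¹` the projective cone over `S ⊆ ℙᴺ = |L|`, vertex `v`,
`X := Bl_v W = ℙ(𝒪_S ⊕ L)` with `ρ : X → S`, disjoint sections `S₀` (normal bundle `L⁻¹`, contracted to
`v`) and `S_∞` (normal bundle `L`), `ι := π : X → W` the blow-down, `p := 2`.
(1) `W(ℂ) = X(ℂ)/S₀(ℂ)` (proper map, bijective off `S₀`), so `H⁴(W) = H⁴(X, S₀) ↪ H⁴(X)` (the map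
`H³(X) → H³(S₀)` is onto: `ρ^*` splits it) with image `ker (H⁴(X) → H⁴(S₀)) = ξ ∪ ρ^* H²(S)`,
`ξ = [S_∞]` (Leray–Hirsch; `ξ|_{S₀} = 0`); write `w_b ↦ ξ ∪ ρ^* b`, `b ∈ H²(S)`; `π^* w_b = ξ ∪ ρ^* b`.
(2) `N² H⁴(W) = H⁴(W)`: (a) for `b` with `∫_S b ∪ c₁(L) = 0`, `w_b` dies off the closed point `v`
(coheight `3 ≥ 2`): `W ∖ v = X ∖ S₀` retracts onto `S_∞` and `(ξ ∪ ρ^*b)|_{S_∞} = c₁(L) ∪ b = 0` in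
`H⁴(S) = ℂ`; (b) for `b = [D]`, `D ⊆ S` a curve, `w_{[D]}` dies off the curve `π(D_∞)` (codim 2, misses
`v`): `ξ ∪ ρ^*[D] = [D_∞]` dies off `D_∞`, and `H⁴(W ∖ πD_∞) = H⁴(X ∖ D_∞, S₀) ↪ H⁴(X ∖ D_∞)` (same
splitting); (c) `L^⊥ + NS(S)_ℂ = H²(S)` since `L² > 0`. So EVERY class of `H⁴(W)` is "algebraic" on the
coniveau carrier — although `H⁴(W) ≅ H²(S)(−1)` has `h^{3,1} = p_g(S) ≠ 0`: the carrier leaves the Hodge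
classes on singular `W` (cousin of Bloch 1990 / Barbieri-Viale–Srinivas 1994 in the barrier catalogue).
(3) `ι^* w_τ = ξ ∪ ρ^* τ ∉ N² H⁴(X) = ρ^* H⁴(S) ⊕ ξ ∪ ρ^* NS(S)_ℂ` for `τ ∉ NS(S)_ℂ` (uniqueness in
Leray–Hirsch; `N² = ` cycle span on the smooth projective `X`, `CH²(ℙ(𝒪 ⊕ L)) = ρ^*CH² ⊕ ξ·ρ^*CH¹`).
With `τ` rational, `c' = w_τ` is even a RATIONAL class; it cannot be taken Hodge `(2,2)` (then
`τ ∈ NS_ℚ` by Lefschetz (1,1)) — consistent with HC.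
WITNESS (formal; shows finite type is used too): `W := X ×_ℂ Spec ℂ[t]_{(t)}`, `ι` the section at the
closed point: `W(ℂ) = X(ℂ)` (the local ring has one `ℂ`-point), `Z := ` fibre over the closed point has
all coheights `≥ 1` and `(W ∖ Z)(ℂ) = ∅`, so `N¹ H²(W) = ⊤` and `ι^*` is an isomorphism; false as soon as
`N¹ H²(X) ≠ H²(X)` (`b₂ > ρ`).
OBSTRUCTION TO A KERNEL PROOF: both witnesses need a smooth projective `X` on the tree's carriers with a
CERTIFIED non-algebraic class (`algebraicClasses X p ≠ ⊤`, `0 < p < dim X`); no restriction map in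
singular cohomology of a constructed variety is computed anywhere in the tree (same open witness as the
sibling disproof files `Cruxes/AnchorExistence/Disproof.lean` §6, `Cruxes/HeckePrymAnchors/Disproof.lean`
§5), and the cone needs Leray–Hirsch for `ℙ(𝒪 ⊕ L)`, the contraction `X → W` as a `ℂ`-scheme morphism and
the quotient description of `W(ℂ)`. Tried for something cheaper: `p = 1` — no finite-type witness known to
me (cones give `H²(W) = ℂ · ξ`, all algebraic; the formal witness covers `p = 1`); small/finite models —
none exist (every carrier is singular cohomology of a complex manifold). [cite: Fulton1998, §19.1 Lemma 19.1.1 and §19.2 Cor. 19.2 (b)] [cite: Hartshorne1977, V Example 2.11.4] -/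
theorem pullbackAlgebraic_false_without_smoothTarget : ¬ PullbackAlgebraicWithoutSmoothTarget := by
  sorry

/-! ### `hX` is NOT load-bearing (information for the provers)

`PullbackAlgebraicWithoutSourceHyps` is TRUE in print for `W` smooth (quasi-)projective and `X` ANY
`ℂ`-scheme of finite type (paper): `Nᵖ H²ᵖ(W)` is the span of the `cl_W(Z)` (Fulton §19.1, `W` smooth);
stratify `X = ⊔ S_j` by the fibre dimension `e_j` of `ι`, `V_j := closure ι(S_j)`, `dim V_j = dim S_j − e_j`;
by Chow's moving lemma on the smooth quasi-projective `W` (Fulton §11.4, Voisin II Lemma 9.22) replace `Z`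
by a rationally equivalent `Z' = Σ nₗ Z'ₗ` meeting every `V_j ∩ X_a` properly (`X_a` the components of
`X`); then `dim (ι⁻¹Z'ₗ ∩ S_j ∩ X_a) ≤ dim X_a − p`, i.e. every point of `ι⁻¹ Z'ₗ` has coheight `≥ p` in `X`,
`cl_W(Z) = Σ nₗ cl_W(Z'ₗ)` (`W` smooth), and `ι^* cl_W(Z'ₗ)` dies off `ι⁻¹ Z'ₗ` by naturality of
restriction — which is MEMBERSHIP in `Nᵖ H²ᵖ(X)` by definition, whatever the singularities of `X`.
So smoothness / projectivity / irreducibility of `X` are conveniences of the chosen proofs (graph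
`X ⊗ W` smooth projective; `Nᵖ(X)` = cycle span), not of the statement. Not formalised (moving lemma).
-/

/-! ## §3 Natural strengthenings -/

/-- **Full contravariance of the coniveau filtration** `ι^*(Nᶜ Hᵏ(W)) ⊆ Nᶜ Hᵏ(X)` for all `k, c`
(the stub `ConiveauContravariant` of the r1-k2 ideation Sketch). TRUE in print (Deligne span — proved in
tree as `supportedClasses_eq_iSup_range_complexGysin` — and the action of the composite correspondence
`ᵗΓ_ι ∘ Γ_g ∈ CH_{dim X − c}(Ỹ × X)`, which lands in classes dying off its projection to `X`, of
codimension `≥ c`: C. Voisin, Hodge and generalized Hodge conjectures, coniveau and algebraic cycles,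
JOMP 1 (2025), p. 27 ll. 27–32 and Def. 4.1; Fulton Ch. 16 for `(Γ' ∘ Γ)_* = Γ'_* ∘ Γ_*`). Not refutable;
it is the crux for `k = 2c` (below). [cite: DeligneHodgeIII1974, Cor. 8.2.8] [cite: Fulton1998, §16.1] -/
def ConiveauContravariant : Prop :=
  ∀ ⦃n : ℕ⦄ ⦃X : SchemeOver ℂ⦄, IsSmoothProjective n X →
    ∀ ⦃m : ℕ⦄ ⦃W : SchemeOver ℂ⦄, IsSmoothProjective m W →
      ∀ (ι : X ⟶ W) (k c : ℕ) (x : complexBetti W k),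
        x ∈ supportedClasses W k c → complexBetti.map ι k x ∈ supportedClasses X k c

/-- `ConiveauContravariant` specialises to the crux at `k = 2c` (`algebraicClasses = supportedClasses _ (2p) p`).
[cite: GrothendieckTopology1969, §1] -/
theorem pullbackAlgebraic_of_coniveauContravariant (h : ConiveauContravariant) :
    BoundaryReadout.PullbackAlgebraic :=
  fun _ _ hX _ _ hW ι p c' hc' ↦ h hX hW ι (2 * p) p c' hc'

/-! ## §4 Degenerate regimes — all true, all already in the tree (crux binder shape) -/

section Regimes

variable {n m : ℕ} {X W : SchemeOver ℂ}

/-- `p = 0` or `dim X ≤ p`: `Nᵖ H²ᵖ(X) = ⊤` there; ANY `ι`, any class. [cite: VoisinHodgeI2002, §11.1.2 and §11.3] -/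
theorem crux_of_eq_zero_or_dim_le (hX : IsSmoothProjective n X) (ι : X ⟶ W) {p : ℕ}
    (hp : p = 0 ∨ n ≤ p) (c' : complexBetti W (2 * p)) :
    complexBetti.map ι (2 * p) c' ∈ algebraicClasses X p :=
  map_mem_algebraicClasses_of_eq_zero_or_dim_le hX ι hp c'

/-- Curves and points as sources: every `p`. [cite: VoisinHodgeI2002, §11.3] -/
theorem crux_of_dim_le_one (hX : IsSmoothProjective n X) (hn : n ≤ 1) (ι : X ⟶ W) (p : ℕ)
    (c' : complexBetti W (2 * p)) : complexBetti.map ι (2 * p) c' ∈ algebraicClasses X p :=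
  map_mem_algebraicClasses_of_dim_le_one hX hn ι p c'

/-- `p = 1`, any `ι` (Lefschetz (1,1) on `X`; needs `hW` for the Hodge type of `N¹(W)`).
[cite: VoisinHodgeI2002, Thm. 11.30] -/
theorem crux_of_p_eq_one (hX : IsSmoothProjective n X) (hW : IsSmoothProjective m W) (ι : X ⟶ W)
    {c' : complexBetti W (2 * 1)} (hc' : c' ∈ algebraicClasses W 1) :
    complexBetti.map ι (2 * 1) c' ∈ algebraicClasses X 1 :=
  Theorems.HodgeBeyondAnchors.map_mem_algebraicClasses_one hW hX ι hc'

/-- `dim X ≤ p + 1`, any `ι` (hard Lefschetz + Lefschetz (1,1)). [cite: VoisinHodgeI2002, Thm. 6.25 and Thm. 11.30] -/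
theorem crux_of_dim_le_add_one (hX : IsSmoothProjective n X) (hW : IsSmoothProjective m W) {p : ℕ}
    (hnp : n ≤ p + 1) (ι : X ⟶ W) {c' : complexBetti W (2 * p)} (hc' : c' ∈ algebraicClasses W p) :
    complexBetti.map ι (2 * p) c' ∈ algebraicClasses X p :=
  Theorems.HodgeBeyondAnchors.map_mem_algebraicClasses_of_dim_le_add_one hW hX hnp ι hc'

/-- `dim X ≤ 3`, any `ι`, any `p` (HC for curves, surfaces, threefolds). [cite: VoisinHodgeII2003, proof of Prop. 10.26] -/
theorem crux_of_dim_le_three (hX : IsSmoothProjective n X) (hW : IsSmoothProjective m W) (hn : n ≤ 3)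
    (ι : X ⟶ W) (p : ℕ) {c' : complexBetti W (2 * p)} (hc' : c' ∈ algebraicClasses W p) :
    complexBetti.map ι (2 * p) c' ∈ algebraicClasses X p :=
  Theorems.HodgeBeyondAnchors.map_mem_algebraicClasses_of_dim_le_three hW hX hn ι p hc'

/-- `ι` flat (projections, open immersions, smooth maps): codimension does not drop.
[cite: GrothendieckTopology1969, §1] [cite: Hartshorne1977, III Prop. 9.5] -/
theorem crux_of_flat (hX : IsSmoothProjective n X) (hW : IsSmoothProjective m W) (ι : X ⟶ W)
    [Flat ι.left] {p : ℕ} {c' : complexBetti W (2 * p)} (hc' : c' ∈ algebraicClasses W p) :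
    complexBetti.map ι (2 * p) c' ∈ algebraicClasses X p := by
  haveI : IsLocallyNoetherian X.left := Motives.IsSmoothProjective.isLocallyNoetherian_holds hX
  haveI : IsLocallyNoetherian W.left := Motives.IsSmoothProjective.isLocallyNoetherian_holds hW
  exact map_mem_algebraicClasses_of_flat ι hc'

/-- `ι` an isomorphism (no smoothness needed at all). [cite: GrothendieckTopology1969, §1] -/
theorem crux_of_isIso (ι : X ⟶ W) [IsIso ι] {p : ℕ} {c' : complexBetti W (2 * p)}
    (hc' : c' ∈ algebraicClasses W p) : complexBetti.map ι (2 * p) c' ∈ algebraicClasses X p :=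
  map_mem_algebraicClasses_of_isIso ι hc'

/-- `dim W = 0` (`W = Spec ℂ`): `H²ᵖ(W(ℂ)) = 0` for `p ≥ 1`. [cite: HatcherAT2002, Thm. 3.26] -/
theorem crux_of_dim_target_eq_zero (hW : IsSmoothProjective 0 W) (ι : X ⟶ W) {p : ℕ}
    (c' : complexBetti W (2 * p)) : complexBetti.map ι (2 * p) c' ∈ algebraicClasses X p := by
  rcases Nat.eq_zero_or_pos p with rfl | hp
  · rw [algebraicClasses_zero]
    exact Submodule.mem_top
  · haveI := subsingleton_complexBetti hW (k := 2 * p) (by omega)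
    rw [Subsingleton.elim c' 0, map_zero]
    exact Submodule.zero_mem _

end Regimes

/-! ## §5 Line `normal_cone` — stub-by-stub adversarial reading (no stub false as typed)

* STUB 1 `stub_deformationDatum` (∃-statement, pure algebraic geometry). Read back: `T` smooth projective
  curve (ℙ¹), `M = Bl_{X×{t₁}}(Y ⊗ T)` smooth projective of dim `n+r+1` (blow-up along a smooth centre),
  `E = ℙ(N_{X/Y} ⊕ 𝟙)` smooth projective geometrically irreducible of dim `n+r` (a `ℙʳ`-bundle over the
  irreducible `X`), `e` the fibre at `t₀` (closed immersion; the blow-up is an iso off `t₁`), `ρ` =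
  blow-down ≫ `pr_Y`, `J : X ⊗ T ⟶ M` the strict transform of `X × T` — it IS `X × T` because the centre
  `X × {t₁}` is a Cartier divisor in `X × T` — `s` the section at infinity `ℙ(0 ⊕ 𝟙)`, `Zbar Z` the strict
  transform of `Z × T`. Checked clauses: `e⁻¹ Zbar = Z` (blow-up iso over `T ∖ t₁`); `Zbar ⊄ e(Y)`
  (dominates `T`); irreducible; codim in `M` = `codim_Y Z`; `k⁻¹ Zbar = ` exceptional divisor of
  `Bl_{(Z∩X)×t₁}(Z × T)`, a Cartier divisor of `Zbar`, every component of dim `dim Z`, so codim in `E` =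
  `codim_Y Z ≥ p` (empty if `Z ∩ X = ∅`). Degenerate `r`: excluded by `1 ≤ r` (for `r = 0`, `X = Y` and
  the crux is the iso case). VERDICT: true; size is the only risk (Fulton §5.1, B.6; Hartshorne II 8.24).
* STUB 2 `stub_specializationLine`. Read back: `ker (H²ᵖ(Y) → H²ᵖ(Y ∖ e⁻¹W)) ≤ e^*(ker (H²ᵖ(M) → H²ᵖ(M ∖ W)))`.
  Since `e(Y)` is a smooth (Cartier) divisor and `W` is irreducible, `⊄ e(Y)`, every component of
  `W ∩ e(Y)` has dimension `dim W − 1`, so `codim_Y (e⁻¹W) = codim_M W =: p' ≥ p`. If `p' > p` both kernels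
  vanish in degree `2p` (semipurity). If `p' = p`: LHS `= ℂ · cl_Y(e⁻¹W)` (purity, irreducible slice; tree:
  `exists_ker_restrictCompl_le_span_of_isIrreducible`), RHS `∋ e^* cl_M(W) = mult · cl_Y(e⁻¹W)` with
  `mult ≥ 1` (proper intersection with a Cartier divisor, Fulton 7.1 / Ex. 19.2.1) and `cl_Y(e⁻¹W) ≠ 0`.
  Degenerate cases: `W ∩ e(Y) = ∅` is excluded because `IsIrreducible ∅` is false; `p = 0` fine (`W = M`
  allowed: `H⁰ ≅ H⁰`); `W` a point is excluded (in `e(Y)` or empty slice); `2p > 2m` trivial.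
  MUTATION: `ρ` (retraction) is IDLE for truth (used only by the intended pairing proof) — `hρ` possibly
  unnecessary; `¬ (W ⊆ range e)` is LOAD-BEARING (`Stub2WithoutNotSubset` below: `W = e(V)`, `V ⊆ Y` of
  codim `p − 1`; RHS `= ℂ · e^*cl_M(e V) = ℂ · cl_Y(V) ∪ c₁(N_{Y/M}) = 0` when `N_{Y/M}` is trivial (a fibre),
  LHS `∋ cl_Y` of any codim-`p` subvariety of `V`, `≠ 0`); `IsIrreducible (e⁻¹ W)` is LOAD-BEARING
  (`Stub2WithoutIrreducibleSlice`: `M = (ℙ¹)³ ⊇ Y = (ℙ¹)² × {0}`, `W = {xy = t}` irreducible, slice = the two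
  rulings, `p = 1`: LHS `= H²(ℙ¹ × ℙ¹) = ℂ²` — the complement of the two rulings is `ℂ²`, contractible —
  RHS `= ℂ · ([ruling₁] + [ruling₂])`, a line). VERDICT: true as typed, hypotheses minimal up to `ρ`.
* STUB 3a `stub_cupDivisor` (`Nˡ ∪ N¹ ⊆ Nˡ⁺¹`): true (divisors move: `D ∼ D' − D''` avoiding any finite set
  of subvarieties on projective `X`; or the lead's Deligne-span proof). No mutation possible (both
  hypotheses are the objects). VERDICT: true, S–M.
* STUB 3b `stub_bundlePullback`: flat pull-back (`q` is Zariski-locally a base change of `ℙʳ → Spec ℂ`,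
  flatness is local on the target; tree `map_mem_supportedClasses_of_flat`). The local-triviality
  hypothesis is more than needed (flat + locally Noetherian suffices) — harmless. VERDICT: true, S.
* STUB 3c `stub_bundleLerayHirsch` (∃ ζ, (i) `q_*(ζʳ) = c • 1`, `c ≠ 0`, (ii) even-degree Leray–Hirsch
  expansion). `∀ μ` is harmless (`orientationFamily_localClass_ne_zero`: a `ℂ`-orientation is the complex
  one times a non-zero locally constant scalar, so `q_*` changes by `λ_E/λ_X ≠ 0`). `ζ :=` restriction of a
  hyperplane class of `E`: restricts to `d · h`, `d ≥ 1`, on every fibre `ℙʳ` (closed subvariety of positive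
  dimension), hence `ζᵇ|_F = dᵇ hᵇ` is a basis of `H*(ℙʳ; ℂ)` — `ℂ`-coefficients matter here, with `ℤ` one
  would need `d = 1` — and `X(ℂ)` connected makes "non-zero on one fibre" global. `r = 0`: `q` iso,
  `q_* 1 ≠ 0`, expansion trivial. `p > n + r`: `y = 0`, `x = 0`. Indexing `b ≤ min r p`, `x_b ∈ H^{2(p−b)}`:
  matches Leray–Hirsch in degree `2p`. A Zariski-locally trivial `ℙʳ`-bundle over a smooth `X` is `ℙ(V)`
  (Brauer class dies at the generic point, `Br X ↪ Br ℂ(X)`), not needed but reassuring. VERDICT: true, M–L.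
* STUB 3d `stub_lerayHirschReadout`. True by DESCENDING induction on `b` using only the listed
  hypotheses: apply `q_*(– ∪ ζ^{r−b})` to `y_{≤ b} := y − Σ_{b' > b} ζ^{b'} ∪ q^*x_{b'}` (algebraic by
  induction, flat `q^*`, cup with divisor powers); `q_*(ζ^{b'+r−b} ∪ q^*x_{b'}) = x_{b'} ∪ q_*(ζ^{b'+r−b})`.
  TRAP for the prover: for `b' < b` the exponent `j = b' + r − b < r` and the COHOMOLOGICAL `q_*(ζʲ)` would
  live in degree `2(j − r) < 0` — untypeable with `complexGysin` (`a + 2n = b + 2m` has no solution) — so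
  the vanishing of these terms must go through homology (`q_*((q^*x ∪ ζʲ) ⌢ [E]) = x ⌢ q_*(ζʲ ⌢ [E])`,
  `H_{>2n}(X(ℂ)) = 0`), exactly as the stub's docstring says; do not look for a cohomological shortcut.
  MUTATION: `c ≠ 0` is LOAD-BEARING (`Stub3dWithoutCNeZero`: `r = 1`, `ζ := q^*d`, then `q_*ζ = 0` and
  `y = q^*(x₀ + d ∪ x₁)`; take `x₁ = τ` transcendental, `x₀ = −d ∪ τ`: `y = 0 ∈ N²` but `x₁ ∉ N¹`); the flat
  hypothesis and `hcup` are consumed by the induction. No bundle structure is needed for 3d (any `q`,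
  any `ζ` with `q_*ζʳ = c • 1`, `c ≠ 0`): the stub is correctly decoupled from 3c. VERDICT: true, M.
* JOINT SUFFICIENCY: `PullbackAlgebraic_of` / `sectionPullback_of` are sorry-free (kernel-checked by the
  lead); nothing to attack.
-/

section LineNormalCone

variable {m p : ℕ} {M Y : SchemeOver ℂ}

/-- Typed mutant of stub 2 WITHOUT `¬ (W ⊆ Set.range e.left.base)` — FALSE on paper (witness in the
section docstring: `W = e(V)`, `codim_Y V = p − 1`, `e(Y)` a fibre). Recorded so that nobody weakens the
stub in this direction. [cite: Fulton1998, §6.3 (self-intersection) and Example 19.2.1] -/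
def Stub2WithoutNotSubset : Prop :=
  ∀ ⦃m p : ℕ⦄ ⦃M Y : SchemeOver ℂ⦄ (e : Y ⟶ M) (ρ : M ⟶ Y), IsSmoothProjective (m + 1) M →
    IsSmoothProjective m Y → IsClosedImmersion e.left → e ≫ ρ = 𝟙 Y →
    ∀ ⦃W : Set M.left⦄, IsClosed W → IsIrreducible W →
      (∀ w ∈ W, (p : ℕ∞) ≤ Order.coheight w) → IsIrreducible (e.left.base ⁻¹' W) →
      LinearMap.ker (complexBetti.restrictCompl Y (e.left.base ⁻¹' W) (2 * p)).hom ≤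
        (LinearMap.ker (complexBetti.restrictCompl M W (2 * p)).hom).map
          (complexBetti.map e (2 * p)).hom

/-- Typed mutant of stub 2 WITHOUT `IsIrreducible (e⁻¹ W)` — FALSE on paper (witness: the conic
degeneration `{xy = t} ⊆ (ℙ¹)³` sliced at `t = 0`, `p = 1`; LHS `ℂ²`, RHS a line).
[cite: Fulton1998, Example 19.2.1] -/
def Stub2WithoutIrreducibleSlice : Prop :=
  ∀ ⦃m p : ℕ⦄ ⦃M Y : SchemeOver ℂ⦄ (e : Y ⟶ M) (ρ : M ⟶ Y), IsSmoothProjective (m + 1) M →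
    IsSmoothProjective m Y → IsClosedImmersion e.left → e ≫ ρ = 𝟙 Y →
    ∀ ⦃W : Set M.left⦄, IsClosed W → IsIrreducible W →
      (∀ w ∈ W, (p : ℕ∞) ≤ Order.coheight w) → ¬ (W ⊆ Set.range e.left.base) →
      LinearMap.ker (complexBetti.restrictCompl Y (e.left.base ⁻¹' W) (2 * p)).hom ≤
        (LinearMap.ker (complexBetti.restrictCompl M W (2 * p)).hom).map
          (complexBetti.map e (2 * p)).hom

/-- The stub as typed is the common strengthening-back of both mutants (sanity: the mutants really
drop one hypothesis each). [folklore] -/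
theorem stub2_of_withoutNotSubset (h : Stub2WithoutNotSubset) :
    ∀ ⦃m p : ℕ⦄ ⦃M Y : SchemeOver ℂ⦄ (e : Y ⟶ M) (ρ : M ⟶ Y), IsSmoothProjective (m + 1) M →
      IsSmoothProjective m Y → IsClosedImmersion e.left → e ≫ ρ = 𝟙 Y →
      ∀ ⦃W : Set M.left⦄, IsClosed W → IsIrreducible W →
        (∀ w ∈ W, (p : ℕ∞) ≤ Order.coheight w) → ¬ (W ⊆ Set.range e.left.base) →
        IsIrreducible (e.left.base ⁻¹' W) →
        LinearMap.ker (complexBetti.restrictCompl Y (e.left.base ⁻¹' W) (2 * p)).hom ≤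
          (LinearMap.ker (complexBetti.restrictCompl M W (2 * p)).hom).map
            (complexBetti.map e (2 * p)).hom :=
  fun _ _ _ _ e ρ hM hY he heρ _ hWc hWi hWp _ hirr ↦ h e ρ hM hY he heρ hWc hWi hWp hirr

/-- Typed mutant of stub 3d WITHOUT `c ≠ 0` — FALSE on paper (witness: `r = 1`, `ζ = q^* d`,
`x₁ = τ` transcendental, `x₀ = −d ∪ τ`, `y = 0`). [cite: VoisinHodgeI2002, Lemma 7.32] -/
def Stub3dWithoutCNeZero : Prop :=
  ∀ (μ : OrientationFamily) ⦃n r : ℕ⦄ ⦃X E : SchemeOver ℂ⦄ (q : E ⟶ X)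
    (hX : IsSmoothProjective n X) (hE : IsSmoothProjective (n + r) E),
    (∀ (k c : ℕ), ∀ x ∈ supportedClasses X k c, complexBetti.map q k x ∈ supportedClasses E k c) →
    (∀ ⦃m : ℕ⦄ ⦃Y : SchemeOver ℂ⦄, IsSmoothProjective m Y → ∀ (l : ℕ) (a : complexBetti Y (2 * l))
      (d : complexBetti Y (2 * 1)), a ∈ algebraicClasses Y l → d ∈ algebraicClasses Y 1 →
      cupProduct (show 2 * l + 2 * 1 = 2 * (l + 1) by omega) a d ∈ algebraicClasses Y (l + 1)) →
    ∀ (ζ : complexBetti E (2 * 1)), ζ ∈ algebraicClasses E 1 → ∀ (c : ℂ),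
      complexGysin μ hE hX q (show 2 * r + 2 * n = 0 + 2 * (n + r) by omega)
          (Literature.AlgebraicTopology.CharacteristicClasses.cupPow ℂ ζ r) =
        c • singularCohomology.one ℂ (ComplexPoints X) →
      ∀ (p : ℕ) (x : (b : Fin (min r p + 1)) → complexBetti X (2 * (p - (b : ℕ)))),
        (∑ b : Fin (min r p + 1),
            cupProduct (show 2 * (b : ℕ) + 2 * (p - (b : ℕ)) = 2 * p by omega)
              (Literature.AlgebraicTopology.CharacteristicClasses.cupPow ℂ ζ b)
              (complexBetti.map q (2 * (p - (b : ℕ))) (x b))) ∈ algebraicClasses E p →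
        ∀ b : Fin (min r p + 1), x b ∈ algebraicClasses X (p - (b : ℕ))

end LineNormalCone

end Summit.HodgeConjecture.HodgeConjecture.Cruxes.PullbackAlgebraic.Disproof

end
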